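import Summits.ABC.IUTFork.Joshi.BundlingRings
import HarnessLib

/-!
# Joshi's tensor theta-values loci off the support: «`S_p = {1}`, `|S_p| = 1`» (ATS III §7.6.8) and the instance of Lemma 7.6.9.1
# «the theta-values loci are of adelic type» for the tensor loci (7.7.2.1) — proof-only companion of `Joshi/BundlingRings.lean`

Block E (rung LADDER-ABC:A2.E) of the abc-iut cell; seat abc-iut-E-t13 (slot T-13, gen 6). PROOF-ONLY companion (0 `def`s) of the
seat's SIGNATURE file `Joshi/BundlingRings.lean` (p429549: `ATS3.PrimeBundlingDatum` — the §7.5/§7.7 data at ONE rational prime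
`p`: `Vss = 𝕍^{odd,ss}_p`, the pure-tensor map `tprod`, the tensor norms `normT ρ`, the loci `locusBundled` (7.5.3.1) /
`locusTensor` (7.7.2.1), the sizes `tupleNormT` (7.2.2), `sizeAt` (7.2.8), `size` (7.2.9) —, and `ATS3.PrimeBundlingFamily` — the
family over all rational primes with the FINITE `support = {p : 𝕍^{odd,ss}_p ≠ ∅}`), paying the MERGE-DEBT recorded in abc-iut-E-t14's
`Joshi/AdelicSizes.lean` (p-file of slot T-14, docstring of `TensorNorm.isAdelicType_of_subset`: «The instance — that the loci have
the §7.6.8 shape — is stated by the seats typing them (… abc-iut-E-t13 `J3:(7.5.4.1)`)»). Source: K. Joshi, *Construction of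
Arithmetic Teichmüller Spaces III*, arXiv:2401.13508**v4** = [J-III] (UNREFEREED; bib `Joshi2024ATS3`; disputed by
`Mochizuki2024JoshiReport`); locators «p.N l.a–b» = PDF page N, lines a–b of the cell's render
`HOME/lit/renders/Joshi-arxiv-2401.13508/pNNNN.txt`. DEFS-FREEZE respected; no `def`, no `Prop` definition, no instance, no
notation, no axiom, 0 `sorry`. TAKES NO SIDE on [IUTchIII] Cor. 3.12, on Joshi's claims or on Mochizuki's report; typed ≠ proved ≠ endorsed.

## What print says and what is derived

* §7.6.8 (p.64 l.59–67): «if `p` is a prime lying below `V^{odd,ss}` … `S_p = Θ̃_{Joshi,p}` … For all the other primes `p`, `S_p = {1}`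
  (or `S_p` is the unit ball in the `p`-component). Notably … `|S_p| = 1` for all but finitely many primes `p`»; §7.6.9 (1) (p.65
  l.3–4) «`S` is a set of adelic type if `|S_p| = 1` for all but finitely many primes `p`»; **Lemma 7.6.9.1** (p.65 l.7–10) «The set
  `Θ̃^{B_{L′}}_Joshi` and its variants for different choices of the `B`-rings are of adelic type. Proof. This is a consequence of
  the construction of the theta-values sets.»
* DERIVED here for the TENSOR variant (7.7.2.1) `Θ̃^{B̆⊗}_{Joshi,p} ⊂ (B̆⊗_{L′,p})^{ℓ⋇}` of p429549, from the typed construction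
  alone: at a rational prime `p` with `𝕍^{odd,ss}_p = ∅` the odd-semistable bundle `⊕_{w ∈ ∅} B_{E′_w}` is the zero ring (one
  point), the bundled locus (7.5.3.1) is all of it (`locusBundled_eq_univ`), the pure-tensor map sends its only tuple to
  `(1,…,1)`, so **`Θ̃^{B̆⊗}_{Joshi,p} = {1}`** (`locusTensor_eq_singleton_one`) — print's «`S_p = {1}`» — and, as soon as the tensor
  norm at `ρ` is normalised by `|1|_{B̆⊗;ρ} = 1` (hypothesis `h1`; automatic for a ring norm), **`|Θ̃^{B̆⊗}_{Joshi,p}|_ρ = 1`**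
  (`sizeAt_locusTensor_eq_one`) and `|Θ̃^{B̆⊗}_{Joshi,p}|_{B̆⊗} = 1` (`size_locusTensor_eq_one`). For the family: off the finite
  `support` all this applies (`Vss_eq_empty_of_not_mem_support`), hence **the set of rational primes at which the local size
  differs from `1` is finite** (`finite_setOf_sizeAt_ne_one`, `finite_setOf_size_ne_one`) — §7.6.9 (1) «adelic type» for the
  tensor loci, in the `EReal` size vocabulary of p429549 (same shape as E-t14's `TensorNorm.isAdelicType_of_subset` in `ℝ≥0∞`).
  What is NOT derived: «`|S_p| < ∞`» at the support primes (§7.6.9 (2) bounded adelic type; print: «one expects `|S_p| < ∞`»).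

bears_on: LADDER-ABC:A2.E. [claim: Joshi2024ATS3, status: disputed]
-/

noncomputable section

open Set

namespace Summit.ABC.IUTFork.Joshi.ATS3

namespace PrimeBundlingDatum

variable {lstar : ℕ} {Qp Bp : Type} [Field Qp] [CommRing Bp] [Algebra Qp Bp] {I : Type} [Fintype I] [DecidableEq I]
  {E BE : I → Type} [∀ w, Field (E w)] [∀ w, Algebra Qp (E w)] [∀ w, CommRing (BE w)] [∀ w, Algebra Qp (BE w)]
  [∀ w, Algebra Bp (BE w)] {T : Type} [CommRing T] (D : PrimeBundlingDatum lstar Qp Bp I E BE T)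

/-! ## 1. One rational prime `p` with `𝕍^{odd,ss}_p = ∅`: `Θ̃^{B̆⊗}_{Joshi,p} = {1}` and `|{1}|_ρ = 1` -/

/-- If `𝕍^{odd,ss}_p = ∅`, the odd-semistable bundle `⊕_{w ∈ 𝕍^{odd,ss}_p} B_{E′_w}` (7.5.1.4) has exactly one element. [folklore] -/
theorem subsingleton_bundleOdd (h : D.Vss = ∅) : Subsingleton D.BundleOdd := by
  haveI : IsEmpty D.Vss := Finset.isEmpty_coe_sort.2 h
  unfold BundleOdd
  infer_instance

/-- … so every `ℓ⋇`-tuple of it is the tuple `1`. [folklore] -/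
theorem tuple_eq_one (h : D.Vss = ∅) (z : Fin lstar → D.BundleOdd) : z = 1 := by
  haveI := D.subsingleton_bundleOdd h
  exact funext fun j => Subsingleton.elim _ _

/-- If `𝕍^{odd,ss}_p = ∅`, the bundled locus (7.5.3.1) is everything (its defining condition ranges over `w ∈ ∅`). [folklore] -/
theorem locusBundled_eq_univ (h : D.Vss = ∅) : D.locusBundled = univ := by
  haveI : IsEmpty D.Vss := Finset.isEmpty_coe_sort.2 h
  ext z
  simp only [locusBundled, mem_setOf_eq, mem_univ, iff_true]
  exact fun w => isEmptyElim w

/-- If `𝕍^{odd,ss}_p = ∅`, the pure-tensor map sends every tuple to `(1,…,1)` (`⊗` over the empty family is the unit). [folklore] -/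
theorem tprodTuple_eq_one (h : D.Vss = ∅) (z : Fin lstar → D.BundleOdd) : D.tprodTuple z = 1 := by
  rw [D.tuple_eq_one h z]
  exact funext fun j => map_one D.tprod

/-- **§7.6.8 «`S_p = {1}`» DERIVED for the tensor locus (7.7.2.1)**: at a rational prime with `𝕍^{odd,ss}_p = ∅`,
`Θ̃^{B̆⊗}_{Joshi,p} = {(1,…,1)}`. [claim: Joshi2024ATS3, status: disputed] -/
theorem locusTensor_eq_singleton_one (h : D.Vss = ∅) : D.locusTensor = {1} := by
  ext t
  simp only [locusTensor, mem_image, mem_singleton_iff, D.locusBundled_eq_univ h, mem_univ, true_and]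
  constructor
  · rintro ⟨z, rfl⟩
    exact D.tprodTuple_eq_one h z
  · rintro rfl
    exact ⟨1, D.tprodTuple_eq_one h 1⟩

/-- With `|1|_{B̆⊗;ρ} = 1`, the (7.2.2) size of the tuple `(1,…,1)` at `ρ` is `1`. [folklore] -/
theorem tupleNormT_one {ρ : ℝ} (h1 : D.normT ρ 1 = 1) : D.tupleNormT ρ 1 = 1 := by
  unfold tupleNormT
  exact Finset.prod_eq_one fun j _ => by rw [Pi.one_apply, h1]

/-- The (7.2.8) size of the singleton `{(1,…,1)}` at `ρ` is `1` (given `|1|_{B̆⊗;ρ} = 1`). [folklore] -/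
theorem sizeAt_singleton_one {ρ : ℝ} (h1 : D.normT ρ 1 = 1) : D.sizeAt {1} ρ = 1 := by
  unfold sizeAt
  rw [iSup_singleton, D.tupleNormT_one h1]
  rfl

/-- **§7.6.8 «`|S_p| = 1`» DERIVED for the tensor locus at `ρ`**: at a rational prime with `𝕍^{odd,ss}_p = ∅` and a tensor norm
normalised by `|1|_{B̆⊗;ρ} = 1`, `|Θ̃^{B̆⊗}_{Joshi,p}|_ρ = 1`. [claim: Joshi2024ATS3, status: disputed] -/
theorem sizeAt_locusTensor_eq_one (h : D.Vss = ∅) {ρ : ℝ} (h1 : D.normT ρ 1 = 1) : D.sizeAt D.locusTensor ρ = 1 := by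
  rw [D.locusTensor_eq_singleton_one h, D.sizeAt_singleton_one h1]

/-- … and the (7.2.9) size over `ρ ∈ (0,1]` is `1` as well (normalisation at every such `ρ`). [claim: Joshi2024ATS3, status: disputed] -/
theorem size_locusTensor_eq_one (h : D.Vss = ∅) (h1 : ∀ ρ ∈ Ioc (0 : ℝ) 1, D.normT ρ 1 = 1) :
    D.size D.locusTensor = 1 := by
  unfold size
  have hne : (Ioc (0 : ℝ) 1).Nonempty := ⟨1, by norm_num⟩
  have h' : ∀ ρ ∈ Ioc (0 : ℝ) 1, D.sizeAt D.locusTensor ρ = 1 := fun ρ hρ => D.sizeAt_locusTensor_eq_one h (h1 ρ hρ)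
  calc ⨆ ρ ∈ Ioc (0 : ℝ) 1, D.sizeAt D.locusTensor ρ = ⨆ ρ ∈ Ioc (0 : ℝ) 1, (1 : EReal) :=
        iSup_congr fun ρ => iSup_congr fun hρ => h' ρ hρ
    _ = 1 := biSup_const hne

end PrimeBundlingDatum

/-! ## 2. All rational primes: off the finite support the local size is `1` — Lemma 7.6.9.1 for the tensor loci -/

namespace PrimeBundlingFamily

variable {lstar : ℕ} {P : Type} {Qp Bp : P → Type} [∀ p, Field (Qp p)] [∀ p, CommRing (Bp p)] [∀ p, Algebra (Qp p) (Bp p)]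
  {I : P → Type} [∀ p, Fintype (I p)] [∀ p, DecidableEq (I p)] {E BE : (p : P) → I p → Type} [∀ p w, Field (E p w)]
  [∀ p w, Algebra (Qp p) (E p w)] [∀ p w, CommRing (BE p w)] [∀ p w, Algebra (Qp p) (BE p w)] [∀ p w, Algebra (Bp p) (BE p w)]
  {T : P → Type} [∀ p, CommRing (T p)] (A : PrimeBundlingFamily lstar P Qp Bp I E BE T)

/-- Off the support, `𝕍^{odd,ss}_p = ∅` (the field `mem_support_iff` of the signature). [folklore] -/
theorem Vss_eq_empty_of_not_mem_support {p : P} (hp : p ∉ A.support) : (A.loc p).Vss = ∅ :=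
  Finset.not_nonempty_iff_eq_empty.1 fun h => hp ((A.mem_support_iff p).2 h)

/-- **§7.6.8 off the support**: `Θ̃^{B̆⊗}_{Joshi,p} = {1}` for every rational prime `p` not below `𝕍^{odd,ss}`.
[claim: Joshi2024ATS3, status: disputed] -/
theorem locusTensor_eq_singleton_one_of_not_mem_support {p : P} (hp : p ∉ A.support) : (A.loc p).locusTensor = {1} :=
  (A.loc p).locusTensor_eq_singleton_one (A.Vss_eq_empty_of_not_mem_support hp)

/-- **§7.6.8 off the support, sizes**: `|Θ̃^{B̆⊗}_{Joshi,p}|_ρ = 1` for `p` not below `𝕍^{odd,ss}`, given `|1|_{B̆⊗_{L′,p};ρ} = 1`.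
[claim: Joshi2024ATS3, status: disputed] -/
theorem sizeAt_locusTensor_eq_one_of_not_mem_support {p : P} (hp : p ∉ A.support) {ρ : ℝ}
    (h1 : (A.loc p).normT ρ 1 = 1) : (A.loc p).sizeAt (A.loc p).locusTensor ρ = 1 :=
  (A.loc p).sizeAt_locusTensor_eq_one (A.Vss_eq_empty_of_not_mem_support hp) h1

/-- **[J-III] Lemma 7.6.9.1 for the tensor loci (7.7.2.1), at a fixed `ρ`** — §7.6.9 (1) «`|S_p| = 1` for all but finitely many
primes `p`»: if the tensor norms off the support are normalised (`|1|_{B̆⊗;ρ} = 1`), the set of rational primes `p` with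
`|Θ̃^{B̆⊗}_{Joshi,p}|_ρ ≠ 1` is finite (inside the support). DERIVED from the construction, as print says («a consequence of the
construction of the theta-values sets»). [claim: Joshi2024ATS3, status: disputed] -/
theorem finite_setOf_sizeAt_ne_one {ρ : ℝ} (h1 : ∀ p ∉ A.support, (A.loc p).normT ρ 1 = 1) :
    {p : P | (A.loc p).sizeAt (A.loc p).locusTensor ρ ≠ 1}.Finite :=
  A.support.finite_toSet.subset fun p hp => by
    by_contra hps
    exact hp (A.sizeAt_locusTensor_eq_one_of_not_mem_support hps (h1 p hps))

/-- The exceptional set lies inside the support (the §7.6.8 dichotomy). [folklore] -/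
theorem setOf_sizeAt_ne_one_subset_support {ρ : ℝ} (h1 : ∀ p ∉ A.support, (A.loc p).normT ρ 1 = 1) :
    {p : P | (A.loc p).sizeAt (A.loc p).locusTensor ρ ≠ 1} ⊆ A.support := fun p hp => by
  by_contra hps
  exact hp (A.sizeAt_locusTensor_eq_one_of_not_mem_support hps (h1 p hps))

/-- **[J-III] Lemma 7.6.9.1 for the tensor loci, (7.2.9) sizes**: with the normalisation at every `ρ ∈ (0,1]` off the support, the
set of rational primes `p` with `|Θ̃^{B̆⊗}_{Joshi,p}|_{B̆⊗} ≠ 1` is finite. [claim: Joshi2024ATS3, status: disputed] -/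
theorem finite_setOf_size_ne_one (h1 : ∀ p ∉ A.support, ∀ ρ ∈ Ioc (0 : ℝ) 1, (A.loc p).normT ρ 1 = 1) :
    {p : P | (A.loc p).size (A.loc p).locusTensor ≠ 1}.Finite :=
  A.support.finite_toSet.subset fun p hp => by
    by_contra hps
    exact hp ((A.loc p).size_locusTensor_eq_one (A.Vss_eq_empty_of_not_mem_support hps) (h1 p hps))

end PrimeBundlingFamily

end Summit.ABC.IUTFork.Joshi.ATS3

end
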